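import Summits.Ventures.LatticeQCDFlow.Scaling.BooleanStarOneCopyToolkit

/-!
HONEST FRAMING: exact (Metropolis-corrected) sampling algorithms for lattice gauge theory; figures
of merit are autocorrelation/cost numbers at stated couplings and volumes; no continuum-physics
claim.

# BooleanStarPoolEstimates — THE LAST CORNER OF OPEN-MATH ITEM 1 (ii) ON THE HOMOGENEOUS BOOLEAN STAR, CONCRETE HALF (1/2): THE ONE-COPY CHAIN ON THE INTEGERS —
# POSITIVITY, MONOTONICITY, GAPS AND THE BOTTOM OF THE DRIFT, FOR EVERY LAW (lean-2 GEN-33, ours)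

Venture-side (OURS).  Cell `lqcd-flow` (pub-lqcd), unit `pub-lqcd-lean-2-g33`, 2026-08-29.  Chapter T, file 2, on top of `BooleanStarOneCopyToolkit` (S11).  The
one-copy chain of S9/S11 indexed by integers: `q↓(z) = μ_0(b)π_b(z)`, `q↑(z) = μ_0(b̄)π_b̄(z)`, `m = q↑ − q↓`, with `π_b(B) = cB/Δ(B)`, `π_b̄(B) = c·rr(K−B)/Δ(B+1)`,
`Δ(B) = h + cB + c·rr(K−B+1)`, `t = cK`, `0 ≤ rr ≤ 1`, `μ_0(b) > 0`, `μ_0(b̄) ≥ 0`.  This file verifies, by real arithmetic on the closed forms of S11, every hypothesis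
that the abstract budget theorem of T1/T1b (`oneCopyDrift_of_relativeDriftPotential`) asks of the chain:

* §1 (every law) `pool_qd_pos`, `pool_qu_nonneg`, `pool_qu_top` (`q↑(K) = 0`), `pool_qd_mono`, `pool_qd_two` (`q↓(z+1) ≤ 2q↓(z)` for `z ≥ 1`), `pool_qu_anti`,
  `pool_gap_nonneg`, `pool_gap_anti` (S11's positive, decreasing gaps in integer form), **`pool_bottom_exists`** (a bottom `B₀ ∈ [0, K−1]` with
  `m(B₀) ≥ 0 > m(B₀+1)` and `μ_0(b)B₀ ≤ μ_0(b̄)rrK` — the bottom sits inside the pool zone).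
* (next file, `BooleanStarPoolRegime`) **`pool_Q0`** (`rr ≤ μ_0(b)` ⇒ `q↑(B₀) ≤ 3q↓(B₀+1)`), **`pool_Q2a`** (`μ_0(b̄)rrK ≥ μ_0(b)/2`, `μ_0(b)+μ_0(b̄) = 1` ⇒
  `g(z) ≥ μ_0(b)c/(12(h+2t)) = 8ρ` for `0 ≤ z ≤ 2μ_0(b̄)rrK/μ_0(b)` — NO `rr ≤ μ_0(b)` needed: `g ≥ c(ph + rr(t+c))/(Δ(z+1)Δ(z+2))` and `μ_0(b)Δ(z+1)Δ(z+2) ≤ 8(ph + rr(t+c))(h+2t)` there),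
  **`pool_Q2b`** (beyond `2μ_0(b̄)rrK/μ_0(b)`: `|m(z)| ≥ μ_0(b)cz/(2Δ(z))`, so `2ρz·q↓(z+1) ≤ (1/6)|m(z)|(q↓(z+1) − q↑(z))`), **`pool_Q2c`** (`2ρK ≤ |m(K)|/6`).

So with `β = 1/6`, `Bp = ⌊2μ_0(b̄)rrK/μ_0(b)⌋`, `ρ = μ_0(b)c/(96(h+2t))` all of (Q0), (Q2a–c) of T1 hold in the regime `rr ≤ μ_0(b)`, `μ_0(b̄)rrK ≥ μ_0(b)/2` — the
assembly (potential on `ℤ`, McShane, S11 `boolStar_mixingTime_le_of_oneCopyDrift_int`) is T3.  Toy value (work-gen33/numerics/explicit_potential.py; NOTHING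
CLAIMED): the inequality itself holds with `κ ≥ 0.75` in these units; `1/96` is what the crude bounds of this file certify.
NOT CLAIMED: anything measured; optimal constants.  Literature grade (cell rule): OWN, elementary; nothing cited as a fact; no new bib keys.
-/

noncomputable section

namespace Summit.Ventures.LatticeQCDFlow.Scaling

/-! ## §1 The one-copy chain on the integers: positivity, monotonicity, gaps, the bottom -/

section Chain

variable {h c t rr μb μb' : ℝ} {K : ℕ} {qd qu m : ℤ → ℝ}

/-- `q↓(z) > 0` for `1 ≤ z ≤ K`. [ours] -/
theorem pool_qd_pos (hh : 0 < h) (hc : 0 < c) (hrr0 : 0 ≤ rr) (hμb : 0 < μb)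
    (hqd : ∀ z : ℤ, qd z = μb * (c * z / (h + c * z + c * rr * ((K : ℝ) - z + 1))))
    (z : ℤ) (hz : 1 ≤ z) (hzK : z ≤ K) : 0 < qd z := by
  have hz' : (1 : ℝ) ≤ z := by exact_mod_cast hz
  have hzK' : (z : ℝ) ≤ K := by exact_mod_cast hzK
  rw [hqd]
  exact mul_pos hμb (div_pos (by positivity) (oneCopy_den_pos hh hc.le hrr0 (by linarith) (by linarith)))

/-- `q↑(z) ≥ 0` for `0 ≤ z ≤ K`. [ours] -/
theorem pool_qu_nonneg (hh : 0 < h) (hc : 0 < c) (hrr0 : 0 ≤ rr) (hμb' : 0 ≤ μb')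
    (hqu : ∀ z : ℤ, qu z = μb' * (c * ((K : ℝ) - z) * rr / (h + c * ((K : ℝ) - z) * rr + c * (z + 1))))
    (z : ℤ) (hz : 0 ≤ z) (hzK : z ≤ K) : 0 ≤ qu z := by
  have hz' : (0 : ℝ) ≤ z := by exact_mod_cast hz
  have hzK' : (z : ℝ) ≤ K := by exact_mod_cast hzK
  rw [hqu]
  have h1 : 0 ≤ c * ((K : ℝ) - z) * rr := mul_nonneg (mul_nonneg hc.le (by linarith)) hrr0
  have h2 : 0 ≤ c * ((z : ℝ) + 1) := by positivity
  have h3 : 0 < h + c * ((K : ℝ) - z) * rr + c * (z + 1) := by linarith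
  exact mul_nonneg hμb' (div_nonneg h1 h3.le)

/-- `q↑(K) = 0`: no disliked content is left to draw at the top. [ours] -/
theorem pool_qu_top (hqu : ∀ z : ℤ, qu z = μb' * (c * ((K : ℝ) - z) * rr / (h + c * ((K : ℝ) - z) * rr + c * (z + 1)))) : qu K = 0 := by
  rw [hqu]; push_cast; simp

/-- `q↓` is non-decreasing on `[0, K]`. [ours] -/
theorem pool_qd_mono (hh : 0 < h) (hc : 0 < c) (hrr0 : 0 ≤ rr) (hμb : 0 < μb)
    (hqd : ∀ z : ℤ, qd z = μb * (c * z / (h + c * z + c * rr * ((K : ℝ) - z + 1))))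
    (z : ℤ) (hz : 0 ≤ z) (hzK : z + 1 ≤ K) : qd z ≤ qd (z + 1) := by
  have hz' : (0 : ℝ) ≤ z := by exact_mod_cast hz
  have hzK' : (z : ℝ) + 1 ≤ K := by exact_mod_cast hzK
  have d0 := oneCopy_den_pos (K := (K : ℝ)) (B := (z : ℝ)) hh hc.le hrr0 hz' (by linarith)
  have d1 := oneCopy_den_pos (K := (K : ℝ)) (B := (z : ℝ) + 1) hh hc.le hrr0 (by linarith) (by linarith)
  have e := oneCopy_pib_sub (πb := fun B : ℝ => c * B / (h + c * B + c * rr * ((K : ℝ) - B + 1))) (B₁ := (z : ℝ)) (B₂ := (z : ℝ) + 1)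
    (fun B => rfl) d0.ne' d1.ne'
  have pos : 0 ≤ c * ((z : ℝ) + 1 - z) * (h + c * rr * (K + 1))
      / ((h + c * z + c * rr * (K - z + 1)) * (h + c * (z + 1) + c * rr * (K - (z + 1) + 1))) := by
    apply div_nonneg _ (mul_pos d0 d1).le
    have : 0 ≤ c * rr * ((K : ℝ) + 1) := by positivity
    have : ((z : ℝ) + 1 - z) = 1 := by ring
    rw [this]; positivity
  rw [hqd, hqd]; push_cast
  have := mul_le_mul_of_nonneg_left (show (0 : ℝ) ≤ _ from le_of_le_of_eq pos e.symm) hμb.le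
  linarith

/-- `q↓(z+1) ≤ 2q↓(z)` for `1 ≤ z ≤ K−1` (`(z+1)/z ≤ 2` and `Δ(z) ≤ Δ(z+1)`). [ours] -/
theorem pool_qd_two (hh : 0 < h) (hc : 0 < c) (hrr0 : 0 ≤ rr) (hrr1 : rr ≤ 1) (hμb : 0 < μb)
    (hqd : ∀ z : ℤ, qd z = μb * (c * z / (h + c * z + c * rr * ((K : ℝ) - z + 1))))
    (z : ℤ) (hz : 1 ≤ z) (hzK : z + 1 ≤ K) : qd (z + 1) ≤ 2 * qd z := by
  have hz' : (1 : ℝ) ≤ z := by exact_mod_cast hz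
  have hzK' : (z : ℝ) + 1 ≤ K := by exact_mod_cast hzK
  have d0 := oneCopy_den_pos (K := (K : ℝ)) (B := (z : ℝ)) hh hc.le hrr0 (by linarith) (by linarith)
  have d01 : h + c * (z : ℝ) + c * rr * (K - z + 1) ≤ h + c * ((z : ℝ) + 1) + c * rr * (K - (z + 1) + 1) := by
    have : 0 ≤ c * (1 - rr) := mul_nonneg hc.le (by linarith)
    nlinarith
  rw [hqd, hqd]; push_cast
  have step : c * ((z : ℝ) + 1) / (h + c * ((z : ℝ) + 1) + c * rr * (K - (z + 1) + 1)) ≤ 2 * (c * z / (h + c * z + c * rr * (K - z + 1))) := by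
    calc c * ((z : ℝ) + 1) / (h + c * ((z : ℝ) + 1) + c * rr * (K - (z + 1) + 1))
        ≤ c * ((z : ℝ) + 1) / (h + c * z + c * rr * (K - z + 1)) := div_le_div_of_nonneg_left (by positivity) d0 d01
      _ ≤ 2 * (c * z) / (h + c * z + c * rr * (K - z + 1)) := div_le_div_of_nonneg_right (by nlinarith [hc.le]) d0.le
      _ = _ := by ring
  have := mul_le_mul_of_nonneg_left step hμb.le
  linarith

/-- `q↑` is non-increasing on `[0, K]`. [ours] -/
theorem pool_qu_anti (hh : 0 < h) (hc : 0 < c) (hrr0 : 0 ≤ rr) (hμb' : 0 ≤ μb')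
    (hqu : ∀ z : ℤ, qu z = μb' * (c * ((K : ℝ) - z) * rr / (h + c * ((K : ℝ) - z) * rr + c * (z + 1))))
    (z : ℤ) (hz : 0 ≤ z) (hzK : z + 1 ≤ K) : qu (z + 1) ≤ qu z := by
  have hz' : (0 : ℝ) ≤ z := by exact_mod_cast hz
  have hzK' : (z : ℝ) + 1 ≤ K := by exact_mod_cast hzK
  have d1 : 0 < h + c * ((K : ℝ) - z) * rr + c * (z + 1) := by
    rw [oneCopy_den_shift]; exact oneCopy_den_pos hh hc.le hrr0 (by linarith) (by linarith)
  have d2 : 0 < h + c * ((K : ℝ) - (z + 1)) * rr + c * (z + 1 + 1) := by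
    rw [oneCopy_den_shift]; exact oneCopy_den_pos hh hc.le hrr0 (by linarith) (by linarith)
  have e := oneCopy_pib'_sub (πb' := fun B : ℝ => c * ((K : ℝ) - B) * rr / (h + c * ((K : ℝ) - B) * rr + c * (B + 1))) (B₁ := (z : ℝ)) (B₂ := (z : ℝ) + 1)
    (fun B => rfl) d1.ne' d2.ne'
  have pos : 0 ≤ c * rr * ((z : ℝ) + 1 - z) * (h + c * (K + 1))
      / ((h + c * (K - z) * rr + c * (z + 1)) * (h + c * (K - (z + 1)) * rr + c * (z + 1 + 1))) := by
    apply div_nonneg _ (mul_pos d1 d2).le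
    have : 0 ≤ c * ((K : ℝ) + 1) := by positivity
    have : ((z : ℝ) + 1 - z) = 1 := by ring
    rw [this]; positivity
  rw [hqu, hqu]; push_cast
  have := mul_le_mul_of_nonneg_left (show (0 : ℝ) ≤ _ from le_of_le_of_eq pos e.symm) hμb'
  linarith

/-- The gaps are non-negative: `m(z+1) ≤ m(z)` on `[0, K−1]` (S11 `oneCopy_gap_pos`). [ours] -/
theorem pool_gap_nonneg (hh : 0 < h) (hc : 0 < c) (hrr0 : 0 ≤ rr) (hμb : 0 < μb) (hμb' : 0 ≤ μb')
    (hqd : ∀ z : ℤ, qd z = μb * (c * z / (h + c * z + c * rr * ((K : ℝ) - z + 1))))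
    (hqu : ∀ z : ℤ, qu z = μb' * (c * ((K : ℝ) - z) * rr / (h + c * ((K : ℝ) - z) * rr + c * (z + 1))))
    (hm : ∀ z, m z = qu z - qd z) (z : ℤ) (hz : 0 ≤ z) (hzK : z + 1 ≤ K) : m (z + 1) ≤ m z := by
  have hz' : (0 : ℝ) ≤ z := by exact_mod_cast hz
  have hzK' : (z : ℝ) + 1 ≤ K := by exact_mod_cast hzK
  have g := oneCopy_gap_pos (K := (K : ℝ)) (πb := fun B : ℝ => c * B / (h + c * B + c * rr * ((K : ℝ) - B + 1)))
    (πb' := fun B : ℝ => c * ((K : ℝ) - B) * rr / (h + c * ((K : ℝ) - B) * rr + c * (B + 1)))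
    (m := fun B : ℝ => μb' * (c * ((K : ℝ) - B) * rr / (h + c * ((K : ℝ) - B) * rr + c * (B + 1))) - μb * (c * B / (h + c * B + c * rr * ((K : ℝ) - B + 1))))
    (B := (z : ℝ)) (fun B => rfl) (fun B => rfl) (fun B => rfl) hh hc hrr0 hμb hμb' hz' hzK'
  rw [hm, hm, hqu, hqu, hqd, hqd]; push_cast
  linarith

/-- The gaps are non-increasing: `m(z+1) − m(z+2) ≤ m(z) − m(z+1)` on `[0, K−2]` (S11 `oneCopy_gap_antitone`). [ours] -/
theorem pool_gap_anti (hh : 0 < h) (hc : 0 < c) (hrr0 : 0 ≤ rr) (hrr1 : rr ≤ 1) (hμb : 0 < μb) (hμb' : 0 ≤ μb')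
    (hqd : ∀ z : ℤ, qd z = μb * (c * z / (h + c * z + c * rr * ((K : ℝ) - z + 1))))
    (hqu : ∀ z : ℤ, qu z = μb' * (c * ((K : ℝ) - z) * rr / (h + c * ((K : ℝ) - z) * rr + c * (z + 1))))
    (hm : ∀ z, m z = qu z - qd z) (z : ℤ) (hz : 0 ≤ z) (hzK : z + 2 ≤ K) : m (z + 1) - m (z + 2) ≤ m z - m (z + 1) := by
  have hz' : (0 : ℝ) ≤ z := by exact_mod_cast hz
  have hzK' : (z : ℝ) + 2 ≤ K := by exact_mod_cast hzK
  have g := oneCopy_gap_antitone (K := (K : ℝ)) (πb := fun B : ℝ => c * B / (h + c * B + c * rr * ((K : ℝ) - B + 1)))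
    (πb' := fun B : ℝ => c * ((K : ℝ) - B) * rr / (h + c * ((K : ℝ) - B) * rr + c * (B + 1)))
    (m := fun B : ℝ => μb' * (c * ((K : ℝ) - B) * rr / (h + c * ((K : ℝ) - B) * rr + c * (B + 1))) - μb * (c * B / (h + c * B + c * rr * ((K : ℝ) - B + 1))))
    (B := (z : ℝ)) (fun B => rfl) (fun B => rfl) (fun B => rfl) hh hc.le hrr0 hrr1 hμb.le hμb' hz' hzK'
  rw [hm, hm, hm, hqu, hqu, hqu, hqd, hqd, hqd]; push_cast
  rw [show (z : ℝ) + 2 = (z : ℝ) + 1 + 1 by ring]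
  linarith

/-- **THE BOTTOM OF THE DRIFT.**  For `K ≥ 1` there is an integer `B₀` with `0 ≤ B₀ ≤ K−1`, `m(B₀) ≥ 0 > m(B₀+1)`, and `μ_0(b)·B₀ ≤ μ_0(b̄)·rr·K` (so the bottom lies
inside the pool zone `[0, 2μ_0(b̄)rrK/μ_0(b)]`): the greatest index below `K` with non-negative drift (`m(0) = q↑(0) ≥ 0`, `m(K) = −q↓(K) < 0`). [ours] -/
theorem pool_bottom_exists (hh : 0 < h) (hc : 0 < c) (hrr0 : 0 ≤ rr) (hrr1 : rr ≤ 1) (hμb : 0 < μb) (hμb' : 0 ≤ μb') (hK : 1 ≤ K)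
    (hqd : ∀ z : ℤ, qd z = μb * (c * z / (h + c * z + c * rr * ((K : ℝ) - z + 1))))
    (hqu : ∀ z : ℤ, qu z = μb' * (c * ((K : ℝ) - z) * rr / (h + c * ((K : ℝ) - z) * rr + c * (z + 1))))
    (hm : ∀ z, m z = qu z - qd z) :
    ∃ B₀ : ℤ, 0 ≤ B₀ ∧ B₀ + 1 ≤ K ∧ 0 ≤ m B₀ ∧ m (B₀ + 1) < 0 ∧ μb * B₀ ≤ μb' * rr * K := by
  classical
  let P : ℕ → Prop := fun n => 0 ≤ m n
  let n₀ := Nat.findGreatest P (K - 1)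
  have hP0 : P 0 := by
    show 0 ≤ m ((0 : ℕ) : ℤ)
    have := pool_qu_nonneg (K := K) hh hc hrr0 hμb' hqu 0 le_rfl (by exact_mod_cast Nat.zero_le K)
    rw [hm, hqd]; push_cast; simp; exact this
  have spec : 0 ≤ m (n₀ : ℤ) := Nat.findGreatest_spec (Nat.zero_le _) hP0
  have hle : n₀ ≤ K - 1 := Nat.findGreatest_le _
  have hle' : (n₀ : ℤ) + 1 ≤ K := by omega
  refine ⟨n₀, by positivity, hle', spec, ?_, ?_⟩
  · -- `m(n₀ + 1) < 0`: by maximality below `K − 1`, and `m(K) = −q↓(K) < 0` at the top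
    rcases lt_or_eq_of_le hle' with hlt | heq
    · have hlt' : n₀ + 1 ≤ K - 1 := by omega
      have := Nat.findGreatest_is_greatest (Nat.lt_succ_self n₀) hlt'
      show m ((n₀ : ℤ) + 1) < 0
      have e : ((n₀ : ℤ) + 1) = ((n₀ + 1 : ℕ) : ℤ) := by push_cast; ring
      rw [e]; exact lt_of_not_ge this
    · rw [heq, hm, pool_qu_top hqu, zero_sub, neg_lt_zero]
      exact pool_qd_pos hh hc hrr0 hμb hqd K (by exact_mod_cast hK) le_rfl
  · -- `μ B₀ ≤ μ̄ rr K` from `q↓(B₀) ≤ q↑(B₀)`, `K − B₀ ≤ K` and `Δ(B₀) ≤ Δ(B₀+1)`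
    have h0 : (0 : ℝ) ≤ (n₀ : ℤ) := by positivity
    have hK' : ((n₀ : ℤ) : ℝ) + 1 ≤ K := by exact_mod_cast hle'
    have d0 := oneCopy_den_pos (K := (K : ℝ)) (B := ((n₀ : ℤ) : ℝ)) hh hc.le hrr0 h0 (by linarith)
    have d01 : h + c * ((n₀ : ℤ) : ℝ) + c * rr * (K - ((n₀ : ℤ) : ℝ) + 1) ≤ h + c * ((K : ℝ) - ((n₀ : ℤ) : ℝ)) * rr + c * (((n₀ : ℤ) : ℝ) + 1) := by
      have : 0 ≤ c * (1 - rr) := mul_nonneg hc.le (by linarith)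
      nlinarith
    have d1 : 0 < h + c * ((K : ℝ) - ((n₀ : ℤ) : ℝ)) * rr + c * (((n₀ : ℤ) : ℝ) + 1) := lt_of_lt_of_le d0 d01
    rw [hm, hqu, hqd, sub_nonneg] at spec
    -- `q↑(B₀) ≤ μ̄ c rr K / Δ(B₀)`
    have up : μb' * (c * ((K : ℝ) - ((n₀ : ℤ) : ℝ)) * rr / (h + c * ((K : ℝ) - ((n₀ : ℤ) : ℝ)) * rr + c * (((n₀ : ℤ) : ℝ) + 1)))
        ≤ μb' * (c * rr * K) / (h + c * ((n₀ : ℤ) : ℝ) + c * rr * (K - ((n₀ : ℤ) : ℝ) + 1)) := by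
      rw [← mul_div_assoc]
      calc μb' * (c * ((K : ℝ) - ((n₀ : ℤ) : ℝ)) * rr) / (h + c * ((K : ℝ) - ((n₀ : ℤ) : ℝ)) * rr + c * (((n₀ : ℤ) : ℝ) + 1))
          ≤ μb' * (c * ((K : ℝ) - ((n₀ : ℤ) : ℝ)) * rr) / (h + c * ((n₀ : ℤ) : ℝ) + c * rr * (K - ((n₀ : ℤ) : ℝ) + 1)) :=
            div_le_div_of_nonneg_left (mul_nonneg hμb' (mul_nonneg (mul_nonneg hc.le (by linarith)) hrr0)) d0 d01
        _ ≤ μb' * (c * rr * K) / (h + c * ((n₀ : ℤ) : ℝ) + c * rr * (K - ((n₀ : ℤ) : ℝ) + 1)) := by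
            apply div_le_div_of_nonneg_right _ d0.le
            apply mul_le_mul_of_nonneg_left _ hμb'
            nlinarith [mul_nonneg hc.le hrr0]
    have key : μb * (c * ((n₀ : ℤ) : ℝ)) / (h + c * ((n₀ : ℤ) : ℝ) + c * rr * (K - ((n₀ : ℤ) : ℝ) + 1))
        ≤ μb' * (c * rr * K) / (h + c * ((n₀ : ℤ) : ℝ) + c * rr * (K - ((n₀ : ℤ) : ℝ) + 1)) := by
      rw [mul_div_assoc]; exact le_trans spec up
    rw [div_le_div_iff_of_pos_right d0] at key
    nlinarith [key, hc]

end Chain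

end Summit.Ventures.LatticeQCDFlow.Scaling

end
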